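import Mathlib
import Summits.MatrixMultiplication.MatrixMultiplication.Theses.ThinBlockAlpha
import Summits.MatrixMultiplication.MatrixMultiplication.Theorems.ThinBlockAlphaRectangularThmBChartSTPP

set_option linter.dupNamespace false

/-!
# STRATEGY-CENSUS sketch (crux-strategist, stmt-MatrixMultiplication-10595, 2026-08-16)

Typed statements referred to in `STRATEGY-CENSUS.md` §Strengthen S2 / §Decomposition D2 / §Negation N4:

* `FixedSeedCharts` — the fixed-seed chart strengthening S⁺⁺ ("∀ a ∃ seed ∀ η"): for every shape
  exponent `a < 1` ONE finite chart (base group `H₀`, alphabet `Fin G`, legs with per-symbol TPP)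
  whose local chart-USP word families reach EVERY slack `η > 0`.  It implies `BoundedThinPackings`
  (exponent of `H₀ⁿ` = exponent of `H₀`) and hence the crux; it is NOT implied by the crux through
  the `n = 1` embedding (an STPP family read as a chart feeds only its own slack, since packing gives
  `|H| > L·N²`).  Recommended as the typed container (E) for crux stmt-14848's chart ideas; NOT
  registered on stmt-10595 (route rev 4 routes typed E through 14848's chain).
* `fixedSeedCharts_imp_thinPackings` — the compiler (C): PROVED here from the tree's
  `stub_chartSTPP` (CKSU Thm 37) — so the split `crux ⟸ E` has `k = 1` open piece.
* `PairLemma` — the necessary condition on TRAPPED charts found by this seat (census N4(a)): in the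
  certificate format of `Theorems/RectangularThmB/Negative/NullChart.lean` (Farkas functional `f`,
  profile maps `p`, tight support `S`, injective symbol profiles), every two distinct symbols carry an
  UNSOLVABLE mixed pattern.  Stated as a `Prop` (proof: on a solvable-closed class the Farkas
  functional is constant, so all its patterns are profile-closed, so tightness + injective labels make
  the profiles constant, so the class is one symbol); kills translation-labelled copies of one
  factorisation type (all their patterns are solvable: `(X−X)+(Y−Y)+(Z−Z) = H₀`).
-/

namespace Summit.MatrixMultiplication.MatrixMultiplication.Cruxes.ThinPackings.StrategyCensus

open Literature.Computability.AlgebraicComplexity (IsSTPP)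
open Summit.MatrixMultiplication.MatrixMultiplication.Theorems (ChartSolvable SymbolTPP IsLocalChartUSP
  stub_chartSTPP)
open Summit.MatrixMultiplication.MatrixMultiplication.Theses.ThinBlockAlpha (ThinPackings BoundedThinPackings)

/-- **S⁺⁺ = fixed-seed charts** (census S2): for every `a < 1` one finite seed chart over a finite
abelian `H₀` with per-symbol TPP such that for every `η > 0` some local chart-USP family of words of one
shape reaches the `(a, η)` slice: blocks `⟨N, M, N⟩`, `2 ≤ N`, `N^a ≤ M`, `|H₀|ⁿ ≤ L · N^{2+η}`. -/
def FixedSeedCharts : Prop :=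
  ∀ a : ℝ, 0 ≤ a → a < 1 →
    ∃ (H₀ : Type) (_ : AddCommGroup H₀) (_ : Fintype H₀) (_ : DecidableEq H₀) (G : ℕ)
      (XA XB XC : Fin G → Finset H₀), (∀ x, SymbolTPP (XA x) (XB x) (XC x)) ∧
      ∀ η : ℝ, 0 < η → ∃ (n L N M : ℕ) (row : Fin L → Fin n → Fin G),
        IsLocalChartUSP XA XB XC row ∧
        (∀ i, (Fintype.piFinset fun c => XA (row i c)).card = N ∧
              (Fintype.piFinset fun c => XB (row i c)).card = M ∧
              (Fintype.piFinset fun c => XC (row i c)).card = N) ∧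
        2 ≤ N ∧ (N : ℝ) ^ a ≤ M ∧ (Fintype.card H₀ : ℝ) ^ n ≤ L * (N : ℝ) ^ (2 + η)

/-- The compiler (C), PROVED: fixed-seed charts give the crux (CKSU Thm 37 = tree `stub_chartSTPP`,
plus `|H₀ⁿ| = |H₀|ⁿ`). [cite: arXiv:math/0511460, Thm. 37] -/
theorem fixedSeedCharts_imp_thinPackings : FixedSeedCharts → ThinPackings := by
  intro hE a ha0 ha1 η hη
  obtain ⟨H₀, i1, i2, i3, G, XA, XB, XC, hTPP, hall⟩ := hE a ha0 ha1
  obtain ⟨n, L, N, M, row, hUSP, hcard, hN, hM, hH⟩ := hall η hη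
  refine ⟨Fin n → H₀, inferInstance, inferInstance, L, N, M,
    fun i => Fintype.piFinset fun c => XA (row i c), fun i => Fintype.piFinset fun c => XB (row i c),
    fun i => Fintype.piFinset fun c => XC (row i c), ?_, hcard, hN, hM, ?_⟩
  · exact stub_chartSTPP H₀ (Fin G) XA XB XC hTPP n L row hUSP
  · have : (Fintype.card (Fin n → H₀) : ℝ) = (Fintype.card H₀ : ℝ) ^ n := by
      rw [Fintype.card_fun, Fintype.card_fin]; push_cast; ring
    rw [this]; exact hH

/-- The same seeds give the sibling crux `BoundedThinPackings` (stmt-14848) with `ℓ = exponent H₀`: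
`FixedSeedCharts` is a strengthening of 14848, which is where it belongs. [folklore] -/
theorem fixedSeedCharts_imp_boundedThinPackings : FixedSeedCharts → BoundedThinPackings := by
  intro hE a ha0 ha1
  obtain ⟨H₀, i1, i2, i3, G, XA, XB, XC, hTPP, hall⟩ := hE a ha0 ha1
  refine ⟨AddMonoid.exponent H₀, fun η hη => ?_⟩
  obtain ⟨n, L, N, M, row, hUSP, hcard, hN, hM, hH⟩ := hall η hη
  refine ⟨Fin n → H₀, inferInstance, inferInstance, L, N, M,
    fun i => Fintype.piFinset fun c => XA (row i c), fun i => Fintype.piFinset fun c => XB (row i c),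
    fun i => Fintype.piFinset fun c => XC (row i c), ?_, ?_, hcard, hN, hM, ?_⟩
  · -- exponent of a finite power is at most (indeed equal to, for n ≥ 1) the exponent of the base
    apply Nat.le_of_dvd (Nat.pos_of_ne_zero AddMonoid.exponent_ne_zero_of_finite)
    apply AddMonoid.exponent_dvd_of_forall_nsmul_eq_zero
    intro g
    funext j
    show AddMonoid.exponent H₀ • g j = 0
    exact AddMonoid.exponent_nsmul_eq_zero (g j)
  · exact stub_chartSTPP H₀ (Fin G) XA XB XC hTPP n L row hUSP
  · have : (Fintype.card (Fin n → H₀) : ℝ) = (Fintype.card H₀ : ℝ) ^ n := by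
      rw [Fintype.card_fun, Fintype.card_fin]; push_cast; ring
    rw [this]; exact hH

/-- **Pair lemma** (census N4(a)), as a statement about the trapped-chart certificate format of
`NullChart.lean`: with a Farkas functional `(f₁,f₂,f₃)` nonnegative on solvable patterns, vanishing
on the diagonal and vanishing on a solvable pattern only when its profile triple lies in a tight
support `S` (integer labels `α β γ`, injective, summing to zero on `S`), and injective symbol
profiles, any two distinct symbols have an unsolvable mixed pattern. -/
def PairLemma : Prop :=
  ∀ (H₀ : Type) [AddCommGroup H₀] (G I J K r : ℕ) (XA XB XC : Fin G → Finset H₀)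
    (p₁ : Fin G → Fin I) (p₂ : Fin G → Fin J) (p₃ : Fin G → Fin K) (f₁ f₂ f₃ : Fin G → ℤ)
    (α : Fin I → Fin r → ℤ) (β : Fin J → Fin r → ℤ) (γ : Fin K → Fin r → ℤ)
    (S : Finset (Fin I × Fin J × Fin K)),
    Function.Injective (fun s => (p₁ s, p₂ s, p₃ s)) →
    (∀ x y z, ChartSolvable XA XB XC x y z →
      0 ≤ f₁ x + f₂ y + f₃ z ∧ (f₁ x + f₂ y + f₃ z = 0 → (p₁ x, p₂ y, p₃ z) ∈ S)) →
    (∀ s, f₁ s + f₂ s + f₃ s = 0) →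
    Function.Injective α → Function.Injective β → Function.Injective γ →
    (∀ s ∈ S, ∀ ρ, α s.1 ρ + β s.2.1 ρ + γ s.2.2 ρ = 0) →
    ∀ x y : Fin G, x ≠ y →
      ¬ ChartSolvable XA XB XC x x y ∨ ¬ ChartSolvable XA XB XC x y x ∨
      ¬ ChartSolvable XA XB XC y x x ∨ ¬ ChartSolvable XA XB XC y y x ∨
      ¬ ChartSolvable XA XB XC y x y ∨ ¬ ChartSolvable XA XB XC x y y

/-- **The pair lemma holds** (census N4(a)): proof as in the docstring — the six mixed patterns over
`{x, y}` force `f` to agree on `x` and `y`, hence all six have Farkas value `0`, hence their profile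
triples lie in `S`, and tightness with injective labels forces equal profiles, so `x = y`. [new] -/
theorem pairLemma : PairLemma := by
  intro H₀ _ G I J K r XA XB XC p₁ p₂ p₃ f₁ f₂ f₃ α β γ S hinj htrap hdiag hα hβ hγ htight x y hxy
  by_contra hall
  push Not at hall
  obtain ⟨h1, h2, h3, h4, h5, h6⟩ := hall
  have dx := hdiag x
  have dy := hdiag y
  have a1 := (htrap _ _ _ h1).1
  have a2 := (htrap _ _ _ h2).1
  have a3 := (htrap _ _ _ h3).1
  have a4 := (htrap _ _ _ h4).1
  have a5 := (htrap _ _ _ h5).1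
  have a6 := (htrap _ _ _ h6).1
  have e1 : f₁ x = f₁ y := by linarith
  have e2 : f₂ x = f₂ y := by linarith
  have e3 : f₃ x = f₃ y := by linarith
  have s1 : (p₁ x, p₂ x, p₃ y) ∈ S := (htrap _ _ _ h1).2 (by linarith)
  have s2 : (p₁ x, p₂ y, p₃ x) ∈ S := (htrap _ _ _ h2).2 (by linarith)
  have s5 : (p₁ y, p₂ x, p₃ y) ∈ S := (htrap _ _ _ h5).2 (by linarith)
  have s6 : (p₁ x, p₂ y, p₃ y) ∈ S := (htrap _ _ _ h6).2 (by linarith)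
  have q1 : p₁ x = p₁ y := by
    apply hα
    funext ρ
    have t1 := htight _ s1 ρ
    have t5 := htight _ s5 ρ
    simp only at t1 t5
    linarith
  have q2 : p₂ x = p₂ y := by
    apply hβ
    funext ρ
    have t1 := htight _ s1 ρ
    have t6 := htight _ s6 ρ
    simp only at t1 t6
    linarith
  have q3 : p₃ x = p₃ y := by
    apply hγ
    funext ρ
    have t2 := htight _ s2 ρ
    have t6 := htight _ s6 ρ
    simp only at t2 t6
    linarith
  have heq : (fun s => (p₁ s, p₂ s, p₃ s)) x = (fun s => (p₁ s, p₂ s, p₃ s)) y := by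
    simp only [q1, q2, q3]
  exact hxy (hinj heq)

end Summit.MatrixMultiplication.MatrixMultiplication.Cruxes.ThinPackings.StrategyCensus
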